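import Mathlib
import HarnessLib
import Summits.Parity.Statement
import Summits.Parity.GeneralizedHardyLittlewood.Theses.TelescopingWindows

/-!
# Assembly of route-Parity-TelescopingWindows (item stmt-Parity-27749)

`Assembly : BoundedSiegelZeroQuality → WindowMeanStep → ShiftLocalConstancyGivenQ → GeneralizedHardyLittlewood`
is literally the route's certified deciding theorem `closes` (node G1.3 «TelescopingWindows», decomp-parity
lens-4 g3): mean of the HL error over a nonempty shift window small + two-point local constancy in shift
space ⟹ the error is small.  One line.
-/

namespace Summit.Parity.GeneralizedHardyLittlewood.Theses.TelescopingWindows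

/-- Assembly item stmt-Parity-27749 of route-Parity-TelescopingWindows:
`BoundedSiegelZeroQuality → WindowMeanStep → ShiftLocalConstancyGivenQ → GeneralizedHardyLittlewood`,
by the route's deciding theorem `closes`. -/
theorem assembly_proof : Assembly :=
  fun hQ hW hC => closes hQ hW hC

end Summit.Parity.GeneralizedHardyLittlewood.Theses.TelescopingWindows
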